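import Literature.Barriers.NavierStokesRegularity.CriticalDataSmoothNonuniquenessConstruction
import Literature.Barriers.NavierStokesRegularity.CriticalDataSmoothNonuniquenessGlobal
import HarnessLib

/-!
# Coiculescu–Palasek 2025, Thm. 1.2: the §5 assembly re-threaded through the perturbation
  theorem AS ITS PRINTED PROOF SUPPORTS IT (`κ ≤ α`), carried as an explicit hypothesis

Third sibling of the proof files of the barrier entry
`Literature/Barriers/NavierStokesRegularity/CriticalDataSmoothNonuniqueness` (D-0021; M. P.
Coiculescu, S. Palasek, *Non-uniqueness of smooth solutions of the Navier–Stokes equations from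
critical data*, Invent. Math. 244 (2025), 165–219, arXiv:2503.14699), next to
`CriticalDataSmoothNonuniquenessConstruction` (the §5 assembly
`CoiculescuPalasek2025_construction_of_parts` from the principal parts — explicit hypothesis `hA` —
and the named fact `CoiculescuPalasek2025_perturbation`, Props. 4.2–4.3) and
`CriticalDataSmoothNonuniquenessAssembly` (its composition with the discharged global extension).

WHY THIS FILE. The named fact `CoiculescuPalasek2025_perturbation` quantifies over every Hölder
exponent `κ ∈ (0, 1/2 - 4α)`, and in that generality it is FALSE: for `κ(1 - 2α) > α` an explicit
smooth shear flow `v = a(t) cos(2πN x₀) e₁` forced by a one-mode residual is an admissible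
approximate solution whose only admissible correction is `w = -v`, violating the `C^{1,κ}` slot of
the conclusion (`not_CoiculescuPalasek2025_perturbation`, sibling file
`CriticalDataSmoothNonuniquenessPerturbationRefuted`; the mechanism is recorded in the section
docstring "Correction (2026-08-15)" of `CriticalDataSmoothNonuniquenessConstruction`). Every
theorem taking `(hB : CoiculescuPalasek2025_perturbation)` is therefore vacuous. The printed proof
of Props. 4.2–4.3 closes exactly in the range `κ ≤ α` (§4.2, proof of Prop. 4.2: the Grönwall
argument is run for `h(t) = (t-t')^{1/2} t^{(1+κ)/2}‖∇S(t,t')‖_{C^κ}`, so the gradient of the semigroup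
carries the weight `t^{-(1+κ)/2}`; fed into the proof of Prop. 4.3 this leaves the factor
`sup_{t ≤ 1} t^{(α-κ)/2}`, finite iff `κ ≤ α`), and in print `κ ∈ (0, 1/2 - 1/(2γ) - 2α)` (§2.4, §4.1)
is a free parameter which may be taken `≤ α` without affecting Def. 3.10–Prop. 4.1 or Thm. 1.2.
This file re-proves the §5 assembly from the CORRECTED perturbation theorem — verbatim the
statement of `CoiculescuPalasek2025_perturbation` with the one additional hypothesis `κ ≤ α` —
carried as the explicit hypothesis `hB` of `CoiculescuPalasek2025_construction_of_parts'`
(D-0026: the corrected statement is a proof obligation of the barrier, stated where it is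
consumed, not a new named fact; a planner may name it), and composes it with the discharged
global extension: `CriticalDataSmoothNonuniqueness_of_principalParts_of_perturbation'`. The only
new step relative to `CoiculescuPalasek2025_construction_of_parts` is to decrease the Hölder
exponent `κ` delivered by the principal parts to `κ₂ = min κ α` before the perturbation theorem
is invoked, which is free because the hypothesis bundle `IsApproximateSolution` is monotone under
decreasing `κ` (`CoiculescuPalasek2025.IsApproximateSolution.of_exponent_le`, proved in
`CriticalDataSmoothNonuniquenessConstruction`); the Hölder slot of `‖w‖_X` is not used by §5.

## References

* M. P. Coiculescu, S. Palasek, Invent. Math. 244 (2025), 165–219,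
  doi:10.1007/s00222-025-01396-z, arXiv:2503.14699: §2.4 (parameters), Def. 3.10, Prop. 3.13,
  §4.1 (Prop. 4.1), §4.2 (Prop. 4.2 and its proof), §4.3 (Prop. 4.3 and its proof), §5 (proof of
  Thm. 1.2), App. B (Prop. B.1, Lemmas B.2–B.3). [`CoiculescuPalasek2025`]
-/

open MeasureTheory Set Filter UnitAddTorus
open _root_.Topology
open scoped InnerProductSpace RealInnerProductSpace ENNReal NNReal

namespace Literature.Barriers.NavierStokesRegularity

open Literature.Analysis.FunctionSpaces CoiculescuPalasek2025

/-- **§5 of Coiculescu–Palasek 2025 below the seam, proved from the perturbation theorem in the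
form its printed proof supports (`κ ≤ α`).** Hypothesis `hA` is literally the hypothesis `hA` of
`CoiculescuPalasek2025_construction_of_parts` (the principal parts with their residuals:
Def. 3.10, Prop. 3.13, Prop. 4.1 and the `v`-only estimates of §5; see that docstring for the
clause-by-clause citations). Hypothesis `hB` is **the perturbation theorem, corrected rendering**
(Props. 4.2–4.3 with App. B and the first paragraph of §5, transported to `(0, T_*] × (ℝ/ℤ)³`):
verbatim the statement of the named fact `CoiculescuPalasek2025_perturbation` (see its docstring
for the clause-by-clause account) with ONE additional hypothesis, `κ ≤ α` — the range of Hölder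
exponents in which the printed proof closes (proof of Prop. 4.2: "defining
`h(t) = (t-t')^{1/2}t^{(1+κ)/2}‖∇S(t,t')‖_{C^κ}` … We conclude once again by Lemma B.3", i.e. the
gradient bound carries the weight `t^{-(1+κ)/2}` in place of the stated `t^{-1/2+ε}`; proof of
Prop. 4.3: the weight `t^{1-α/2}` of `X` then leaves `t^{(α-κ)/2} ≤ 1` iff `κ ≤ α`); without it the
statement is false (`not_CoiculescuPalasek2025_perturbation`). The conclusion is literally that
of `CoiculescuPalasek2025_construction_of_parts` (the hypothesis `h₁` of
`CriticalDataSmoothNonuniqueness_of_parts`). Proof: the proof of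
`CoiculescuPalasek2025_construction_of_parts` (§5) with `α = 1/16`, the exponent `κ` delivered by
`hA` being decreased to `κ₂ = min κ (1/16) ≤ α` (`IsApproximateSolution.of_exponent_le`) before
`hB` is invoked; the `C^{1,κ}` slot of `‖w‖_X ≤ ε₁` is discarded by the assembly.
[cite: CoiculescuPalasek2025, Props. 4.2–4.3 (with their proofs, §§4.2–4.3), App. B (Prop. B.1, Lemmas B.2–B.3), Def. 3.10, Prop. 3.13, Prop. 4.1 and §5 (proof of Thm. 1.2)] -/
theorem CoiculescuPalasek2025_construction_of_parts'
    (hA : ∀ α : ℝ, 0 < α → α < 1 / 8 →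
      ∃ κ : ℝ≥0, 0 < κ ∧ (κ : ℝ) < 1 / 2 - 4 * α ∧
      ∃ (K : ℕ → ℝ) (C : ℝ),
      ∀ (ε₀ η L δ : ℝ), 0 < ε₀ → 0 < η → 0 < δ →
      ∃ (v₁ v₂ : ℝ → UnitAddTorus (Fin 3) → EuclideanSpace ℝ (Fin 3))
        (F₁ F₂ : ℝ → UnitAddTorus (Fin 3) → (Fin 3 → Fin 3 → ℝ))
        (π₁ π₂ : ℝ → UnitAddTorus (Fin 3) → ℝ),
        IsApproximateSolution unitTime α κ K C η ε₀ v₁ F₁ π₁ ∧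
        IsApproximateSolution unitTime α κ K C η ε₀ v₂ F₂ π₂ ∧
        (∃ t₀ ∈ Ioc (0 : ℝ) unitTime, ∃ x₀ : UnitAddTorus (Fin 3),
          L ≤ t₀ ^ ((1 - α) / 2) * ‖v₁ t₀ x₀ - v₂ t₀ x₀‖) ∧
        Tendsto (fun t =>
            Torus.eHomSobolevSeminorm (-1) (EuclideanSpace.complexify ∘ (v₁ t - v₂ t)))
          (𝓝[>] 0) (𝓝 0) ∧
        Tendsto (fun st : ℝ × ℝ =>
            Torus.eHomSobolevSeminorm (-1) (EuclideanSpace.complexify ∘ (v₁ st.1 - v₁ st.2)))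
          ((𝓝[>] (0 : ℝ)) ×ˢ (𝓝[>] (0 : ℝ))) (𝓝 0) ∧
        Tendsto (fun st : ℝ × ℝ =>
            Torus.eHomSobolevSeminorm (-1) (EuclideanSpace.complexify ∘ (v₂ st.1 - v₂ st.2)))
          ((𝓝[>] (0 : ℝ)) ×ˢ (𝓝[>] (0 : ℝ))) (𝓝 0) ∧
        (∀ φ : UnitAddTorus (Fin 3) → EuclideanSpace ℝ (Fin 3), Torus.IsSmooth φ →
          Torus.HasZeroMean φ →
          ∃ c : ℝ, Tendsto (fun t => ∫ x, ⟪v₁ t x, φ x⟫) (𝓝[>] 0) (𝓝 c) ∧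
            Tendsto (fun t => ∫ x, ⟪v₂ t x, φ x⟫) (𝓝[>] 0) (𝓝 c)) ∧
        (∀ x, ‖v₁ unitTime x‖ ≤ δ ∧ ‖v₂ unitTime x‖ ≤ δ))
    (hB : ∀ α : ℝ, 0 < α → α < 1 / 8 →
      ∀ κ : ℝ≥0, 0 < κ → (κ : ℝ) < 1 / 2 - 4 * α → (κ : ℝ) ≤ α →
      ∀ (K : ℕ → ℝ) (C : ℝ),
      ∃ C₄ : ℝ, 0 < C₄ ∧
      ∀ ε₁ : ℝ, 0 < ε₁ → ε₁ < C₄⁻¹ →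
      ∃ ε₀ : ℝ, 0 < ε₀ ∧ ∃ η : ℝ, 0 < η ∧
      ∀ (v : ℝ → UnitAddTorus (Fin 3) → EuclideanSpace ℝ (Fin 3))
        (F : ℝ → UnitAddTorus (Fin 3) → (Fin 3 → Fin 3 → ℝ)) (π : ℝ → UnitAddTorus (Fin 3) → ℝ),
        IsApproximateSolution unitTime α κ K C η ε₀ v F π →
        ∃ (w : ℝ → UnitAddTorus (Fin 3) → EuclideanSpace ℝ (Fin 3))
          (q : ℝ → UnitAddTorus (Fin 3) → ℝ),
          Torus.IsClassicalNSSolutionOn (Ioc 0 unitTime) 1 0 (v + w) q ∧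
          (∀ t ∈ Ioc (0 : ℝ) unitTime, Torus.HasZeroMean (w t)) ∧
          (∀ t ∈ Ioc (0 : ℝ) unitTime, ∀ x, t ^ ((1 - α) / 2) * ‖w t x‖ ≤ ε₁) ∧
          (∀ t ∈ Ioc (0 : ℝ) unitTime,
            ENNReal.ofReal (t ^ (1 - α / 2)) *
                eHolderNorm κ (iteratedFDeriv ℝ 1 (Torus.lift (w t))) ≤
              ENNReal.ofReal ε₁) ∧
          Tendsto (fun t => Torus.eHomSobolevSeminorm (-1) (EuclideanSpace.complexify ∘ w t))
            (𝓝[>] 0) (𝓝 0) ∧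
          ∀ φ : UnitAddTorus (Fin 3) → EuclideanSpace ℝ (Fin 3), Torus.IsSmooth φ →
            Torus.HasZeroMean φ → Tendsto (fun t => ∫ x, ⟪w t x, φ x⟫) (𝓝[>] 0) (𝓝 0)) :
    ∀ ε : ℝ, 0 < ε →
      ∃ T : ℝ, 0 < T ∧
      ∃ (u v : ℝ → UnitAddTorus (Fin 3) → EuclideanSpace ℝ (Fin 3))
        (p₁ p₂ : ℝ → UnitAddTorus (Fin 3) → ℝ),
        Torus.IsClassicalNSSolutionOn (Ioc 0 T) 1 0 u p₁ ∧
        Torus.IsClassicalNSSolutionOn (Ioc 0 T) 1 0 v p₂ ∧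
        (∃ M : ℝ, ∀ t ∈ Ioc (0 : ℝ) T, ∀ x,
          Real.sqrt t * ‖u t x‖ ≤ M ∧ Real.sqrt t * ‖v t x‖ ≤ M) ∧
        (∃ t₀ ∈ Ioc (0 : ℝ) T, u t₀ ≠ v t₀) ∧
        Tendsto (fun t =>
            Torus.eHomSobolevSeminorm (-1) (EuclideanSpace.complexify ∘ (u t - v t)))
          (𝓝[>] 0) (𝓝 0) ∧
        Tendsto (fun st : ℝ × ℝ =>
            Torus.eHomSobolevSeminorm (-1) (EuclideanSpace.complexify ∘ (u st.1 - u st.2)))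
          ((𝓝[>] (0 : ℝ)) ×ˢ (𝓝[>] (0 : ℝ))) (𝓝 0) ∧
        Tendsto (fun st : ℝ × ℝ =>
            Torus.eHomSobolevSeminorm (-1) (EuclideanSpace.complexify ∘ (v st.1 - v st.2)))
          ((𝓝[>] (0 : ℝ)) ×ˢ (𝓝[>] (0 : ℝ))) (𝓝 0) ∧
        (∀ φ : UnitAddTorus (Fin 3) → EuclideanSpace ℝ (Fin 3),
          Torus.IsSmooth φ → Torus.HasZeroMean φ →
          (∃ c : ℝ, Tendsto (fun t => ∫ x, ⟪u t x, φ x⟫) (𝓝[>] 0) (𝓝 c)) ∧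
          (∃ c : ℝ, Tendsto (fun t => ∫ x, ⟪v t x, φ x⟫) (𝓝[>] 0) (𝓝 c)) ∧
          Tendsto (fun t => ∫ x, ⟪u t x - v t x, φ x⟫) (𝓝[>] 0) (𝓝 0)) ∧
        Torus.HasZeroMean (u T) ∧ Torus.HasZeroMean (v T) ∧
        (∀ x, ‖u T x‖ ≤ ε ∧ ‖v T x‖ ≤ ε) := by
  intro ε hε
  -- parameters: `α = 1/16`, then `κ, K, C` (fact 1), `C₄` (fact 2), `ε₁`, then `ε₀, η` (fact 2)
  have hα : (0 : ℝ) < 1 / 16 := by norm_num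
  have hα' : (1 / 16 : ℝ) < 1 / 8 := by norm_num
  obtain ⟨κ, hκ, hκ', K, C, hA⟩ := hA (1 / 16) hα hα'
  -- decrease the Hölder exponent to `κ₂ = min κ (1/16) ≤ α` (the corrected fact needs `κ ≤ α`)
  obtain ⟨κ₂, hκ₂def⟩ : ∃ κ₂ : ℝ≥0, κ₂ = min κ (1 / 16) := ⟨_, rfl⟩
  have hκ₂le : κ₂ ≤ κ := hκ₂def ▸ min_le_left _ _
  have hκ₂ : 0 < κ₂ := hκ₂def ▸ lt_min hκ (by norm_num)
  have hκ₂' : (κ₂ : ℝ) < 1 / 2 - 4 * (1 / 16) := lt_of_le_of_lt (NNReal.coe_le_coe.2 hκ₂le) hκ'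
  have hκ₂α : (κ₂ : ℝ) ≤ 1 / 16 := by
    have h : (κ₂ : ℝ) ≤ ((1 / 16 : ℝ≥0) : ℝ) := NNReal.coe_le_coe.2 (hκ₂def ▸ min_le_right _ _)
    exact h.trans_eq (by norm_num)
  obtain ⟨C₄, hC₄, hB⟩ := hB (1 / 16) hα hα' κ₂ hκ₂ hκ₂' hκ₂α K C
  have hT0 : 0 < unitTime := unitTime_pos
  have hT1 : unitTime ≤ 1 := unitTime_le_one
  have hTmem : unitTime ∈ Ioc (0 : ℝ) unitTime := ⟨hT0, le_rfl⟩
  obtain ⟨c, hc⟩ : ∃ c : ℝ, c = unitTime ^ ((1 - (1 / 16 : ℝ)) / 2) := ⟨_, rfl⟩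
  have hc0 : 0 < c := hc ▸ Real.rpow_pos_of_pos hT0 _
  have hC₄' : 0 < C₄⁻¹ := inv_pos.2 hC₄
  obtain ⟨ε₁, hε₁⟩ : ∃ ε₁ : ℝ, ε₁ = min (C₄⁻¹ / 2) (ε / 2 * c) := ⟨_, rfl⟩
  have hε₁0 : 0 < ε₁ := hε₁ ▸ lt_min (half_pos hC₄') (mul_pos (half_pos hε) hc0)
  have hε₁1 : ε₁ < C₄⁻¹ := hε₁ ▸ (min_le_left _ _).trans_lt (half_lt_self hC₄')
  have hε₁2 : ε₁ ≤ ε / 2 * c := hε₁ ▸ min_le_right _ _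
  obtain ⟨ε₀, hε₀, η, hη, hB⟩ := hB ε₁ hε₁0 hε₁1
  obtain ⟨v₁, v₂, F₁, F₂, π₁, π₂, h₁, h₂, ⟨t₀, ht₀, x₀, hdist⟩, hdat, hc₁, hc₂, hφ, hδ⟩ :=
    hA ε₀ η (3 * ε₁) (ε / 2) hε₀ hη (half_pos hε)
  obtain ⟨w₁, q₁, hu₁, hm₁, hw₁, -, hH₁, hP₁⟩ := hB v₁ F₁ π₁ (h₁.of_exponent_le hκ₂le)
  obtain ⟨w₂, q₂, hu₂, hm₂, hw₂, -, hH₂, hP₂⟩ := hB v₂ F₂ π₂ (h₂.of_exponent_le hκ₂le)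
  -- continuity of all slices on `(0, T_*]`
  have hv₁c : ∀ t ∈ Ioc (0 : ℝ) unitTime, Continuous (v₁ t) := fun t ht => h₁.continuous_slice ht
  have hv₂c : ∀ t ∈ Ioc (0 : ℝ) unitTime, Continuous (v₂ t) := fun t ht => h₂.continuous_slice ht
  have hw₁c : ∀ t ∈ Ioc (0 : ℝ) unitTime, Continuous (w₁ t) := fun t ht => by
    have h := ((hu₁.smooth_velocity.isSmooth_slice ht).continuous).sub (hv₁c t ht)
    rwa [Pi.add_apply, add_sub_cancel_left] at h
  have hw₂c : ∀ t ∈ Ioc (0 : ℝ) unitTime, Continuous (w₂ t) := fun t ht => by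
    have h := ((hu₂.smooth_velocity.isSmooth_slice ht).continuous).sub (hv₂c t ht)
    rwa [Pi.add_apply, add_sub_cancel_left] at h
  -- the sup-norm slot of `‖wᵢ‖_X ≤ ε₁`, in the two forms used below
  have hwKT : ∀ {w : ℝ → UnitAddTorus (Fin 3) → EuclideanSpace ℝ (Fin 3)},
      (∀ t ∈ Ioc (0 : ℝ) unitTime, ∀ x, t ^ ((1 - (1 / 16 : ℝ)) / 2) * ‖w t x‖ ≤ ε₁) →
      ∀ t ∈ Ioc (0 : ℝ) unitTime, ∀ x, Real.sqrt t * ‖w t x‖ ≤ ε₁ := by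
    intro w hw t ht x
    have hsplit : Real.sqrt t = t ^ ((1 / 16 : ℝ) / 2) * t ^ ((1 - (1 / 16 : ℝ)) / 2) := by
      rw [Real.sqrt_eq_rpow, ← Real.rpow_add ht.1]
      norm_num
    have hle1 : t ^ ((1 / 16 : ℝ) / 2) ≤ 1 :=
      Real.rpow_le_one ht.1.le (ht.2.trans hT1) (by norm_num)
    calc Real.sqrt t * ‖w t x‖
        = t ^ ((1 / 16 : ℝ) / 2) * (t ^ ((1 - (1 / 16 : ℝ)) / 2) * ‖w t x‖) := by
          rw [hsplit, mul_assoc]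
      _ ≤ 1 * ε₁ :=
          mul_le_mul hle1 (hw t ht x) (mul_nonneg (Real.rpow_nonneg ht.1.le _) (norm_nonneg _))
            zero_le_one
      _ = ε₁ := one_mul _
  have hwT : ∀ {w : ℝ → UnitAddTorus (Fin 3) → EuclideanSpace ℝ (Fin 3)},
      (∀ t ∈ Ioc (0 : ℝ) unitTime, ∀ x, t ^ ((1 - (1 / 16 : ℝ)) / 2) * ‖w t x‖ ≤ ε₁) →
      ∀ x, ‖w unitTime x‖ ≤ ε / 2 := by
    intro w hw x
    have h := (hw unitTime hTmem x).trans hε₁2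
    rw [← hc, mul_comm (ε / 2) c] at h
    exact le_of_mul_le_mul_left h hc0
  -- triangle inequality pattern for the `Ḣ^{-1}` clauses
  have tri : ∀ {a b p q : UnitAddTorus (Fin 3) → EuclideanSpace ℝ (Fin 3)},
      Continuous a → Continuous b → Continuous p → Continuous q →
      Torus.eHomSobolevSeminorm (-1) (EuclideanSpace.complexify ∘ (a + p - (b + q))) ≤
        Torus.eHomSobolevSeminorm (-1) (EuclideanSpace.complexify ∘ (a - b)) +
          (Torus.eHomSobolevSeminorm (-1) (EuclideanSpace.complexify ∘ p) +
            Torus.eHomSobolevSeminorm (-1) (EuclideanSpace.complexify ∘ q)) := by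
    intro a b p q ha hb hp hq
    rw [← sub_add_sub_comm]
    exact (eHomSobolevSeminorm_complexify_add_le _ (ha.sub hb) (hp.sub hq)).trans
      (add_le_add le_rfl (eHomSobolevSeminorm_complexify_sub_le _ hp hq))
  -- agreement filters at `0⁺`
  have hI : Ioc (0 : ℝ) unitTime ∈ 𝓝[>] (0 : ℝ) := Ioc_mem_nhdsGT hT0
  have hI2 : ∀ᶠ st in (𝓝[>] (0 : ℝ)) ×ˢ (𝓝[>] (0 : ℝ)),
      st.1 ∈ Ioc (0 : ℝ) unitTime ∧ st.2 ∈ Ioc (0 : ℝ) unitTime :=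
    (eventually_of_mem hI fun t ht => ht).prod_mk (eventually_of_mem hI fun t ht => ht)
  refine ⟨unitTime, hT0, v₁ + w₁, v₂ + w₂, q₁, q₂, hu₁, hu₂, ⟨|K 0| + ε₁, fun t ht x => ?_⟩,
    ⟨t₀, ht₀, fun heq => ?_⟩, ?_, ?_, ?_, fun φ hφs hφm => ?_, ?_, ?_, fun x => ?_⟩
  · -- Koch–Tataru bound on `(0, T_*]`
    simp only [Pi.add_apply]
    constructor
    · calc Real.sqrt t * ‖v₁ t x + w₁ t x‖
          ≤ Real.sqrt t * (‖v₁ t x‖ + ‖w₁ t x‖) := by gcongr; exact norm_add_le _ _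
        _ = Real.sqrt t * ‖v₁ t x‖ + Real.sqrt t * ‖w₁ t x‖ := mul_add _ _ _
        _ ≤ |K 0| + ε₁ := add_le_add (h₁.sqrt_mul_norm_le ht x) (hwKT hw₁ t ht x)
    · calc Real.sqrt t * ‖v₂ t x + w₂ t x‖
          ≤ Real.sqrt t * (‖v₂ t x‖ + ‖w₂ t x‖) := by gcongr; exact norm_add_le _ _
        _ = Real.sqrt t * ‖v₂ t x‖ + Real.sqrt t * ‖w₂ t x‖ := mul_add _ _ _
        _ ≤ |K 0| + ε₁ := add_le_add (h₂.sqrt_mul_norm_le ht x) (hwKT hw₂ t ht x)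
  · -- distinct at `t₀`
    have hx : v₁ t₀ x₀ + w₁ t₀ x₀ = v₂ t₀ x₀ + w₂ t₀ x₀ := by
      simpa only [Pi.add_apply] using congrFun heq x₀
    have hvw : v₁ t₀ x₀ - v₂ t₀ x₀ = w₂ t₀ x₀ - w₁ t₀ x₀ := by
      rw [sub_eq_sub_iff_add_eq_add, hx, add_comm]
    have hn : ‖v₁ t₀ x₀ - v₂ t₀ x₀‖ ≤ ‖w₂ t₀ x₀‖ + ‖w₁ t₀ x₀‖ := by
      rw [hvw]; exact norm_sub_le _ _
    have ht₀c : 0 ≤ t₀ ^ ((1 - (1 / 16 : ℝ)) / 2) := Real.rpow_nonneg ht₀.1.le _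
    have key : 3 * ε₁ ≤ ε₁ + ε₁ :=
      calc 3 * ε₁ ≤ t₀ ^ ((1 - (1 / 16 : ℝ)) / 2) * ‖v₁ t₀ x₀ - v₂ t₀ x₀‖ := hdist
        _ ≤ t₀ ^ ((1 - (1 / 16 : ℝ)) / 2) * (‖w₂ t₀ x₀‖ + ‖w₁ t₀ x₀‖) := by gcongr
        _ = t₀ ^ ((1 - (1 / 16 : ℝ)) / 2) * ‖w₂ t₀ x₀‖ +
              t₀ ^ ((1 - (1 / 16 : ℝ)) / 2) * ‖w₁ t₀ x₀‖ := mul_add _ _ _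
        _ ≤ ε₁ + ε₁ := add_le_add (hw₂ t₀ ht₀ x₀) (hw₁ t₀ ht₀ x₀)
    linarith
  · -- common datum in `Ḣ^{-1}`
    have hlim : Tendsto (fun t =>
        Torus.eHomSobolevSeminorm (-1) (EuclideanSpace.complexify ∘ (v₁ t - v₂ t)) +
          (Torus.eHomSobolevSeminorm (-1) (EuclideanSpace.complexify ∘ w₁ t) +
            Torus.eHomSobolevSeminorm (-1) (EuclideanSpace.complexify ∘ w₂ t)))
        (𝓝[>] 0) (𝓝 0) := by
      simpa using hdat.add (hH₁.add hH₂)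
    refine tendsto_of_tendsto_of_tendsto_of_le_of_le' tendsto_const_nhds hlim
      (Eventually.of_forall fun t => zero_le) ?_
    filter_upwards [hI] with t ht
    simp only [Pi.add_apply]
    exact tri (hv₁c t ht) (hv₂c t ht) (hw₁c t ht) (hw₂c t ht)
  · -- `u₁(t)` Cauchy in `Ḣ^{-1}` as `t → 0⁺`
    have hlim : Tendsto (fun st : ℝ × ℝ =>
        Torus.eHomSobolevSeminorm (-1) (EuclideanSpace.complexify ∘ (v₁ st.1 - v₁ st.2)) +
          (Torus.eHomSobolevSeminorm (-1) (EuclideanSpace.complexify ∘ w₁ st.1) +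
            Torus.eHomSobolevSeminorm (-1) (EuclideanSpace.complexify ∘ w₁ st.2)))
        ((𝓝[>] (0 : ℝ)) ×ˢ (𝓝[>] (0 : ℝ))) (𝓝 0) := by
      simpa [Function.comp_def] using
        hc₁.add ((hH₁.comp tendsto_fst).add (hH₁.comp tendsto_snd))
    refine tendsto_of_tendsto_of_tendsto_of_le_of_le' tendsto_const_nhds hlim
      (Eventually.of_forall fun st => zero_le) ?_
    filter_upwards [hI2] with st hst
    simp only [Pi.add_apply]
    exact tri (hv₁c _ hst.1) (hv₁c _ hst.2) (hw₁c _ hst.1) (hw₁c _ hst.2)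
  · -- `u₂(t)` Cauchy in `Ḣ^{-1}` as `t → 0⁺`
    have hlim : Tendsto (fun st : ℝ × ℝ =>
        Torus.eHomSobolevSeminorm (-1) (EuclideanSpace.complexify ∘ (v₂ st.1 - v₂ st.2)) +
          (Torus.eHomSobolevSeminorm (-1) (EuclideanSpace.complexify ∘ w₂ st.1) +
            Torus.eHomSobolevSeminorm (-1) (EuclideanSpace.complexify ∘ w₂ st.2)))
        ((𝓝[>] (0 : ℝ)) ×ˢ (𝓝[>] (0 : ℝ))) (𝓝 0) := by
      simpa [Function.comp_def] using
        hc₂.add ((hH₂.comp tendsto_fst).add (hH₂.comp tendsto_snd))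
    refine tendsto_of_tendsto_of_tendsto_of_le_of_le' tendsto_const_nhds hlim
      (Eventually.of_forall fun st => zero_le) ?_
    filter_upwards [hI2] with st hst
    simp only [Pi.add_apply]
    exact tri (hv₂c _ hst.1) (hv₂c _ hst.2) (hw₂c _ hst.1) (hw₂c _ hst.2)
  · -- distributional pairings against smooth mean-zero test fields
    obtain ⟨c, hcv₁, hcv₂⟩ := hφ φ hφs hφm
    have hφc : Continuous φ := hφs.continuous
    have hadd : ∀ {v w : ℝ → UnitAddTorus (Fin 3) → EuclideanSpace ℝ (Fin 3)},
        (∀ t ∈ Ioc (0 : ℝ) unitTime, Continuous (v t)) →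
        (∀ t ∈ Ioc (0 : ℝ) unitTime, Continuous (w t)) →
        ∀ t ∈ Ioc (0 : ℝ) unitTime,
          ∫ x, ⟪(v + w) t x, φ x⟫ = (∫ x, ⟪v t x, φ x⟫) + ∫ x, ⟪w t x, φ x⟫ := by
      intro v w hv hw t ht
      simp only [Pi.add_apply, inner_add_left]
      exact integral_add (integrable_inner_of_continuous (hv t ht) hφc)
        (integrable_inner_of_continuous (hw t ht) hφc)
    have hu₁t : Tendsto (fun t => ∫ x, ⟪(v₁ + w₁) t x, φ x⟫) (𝓝[>] 0) (𝓝 c) := by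
      have h := hcv₁.add (hP₁ φ hφs hφm)
      rw [add_zero] at h
      refine h.congr' ?_
      filter_upwards [hI] with t ht
      exact (hadd hv₁c hw₁c t ht).symm
    have hu₂t : Tendsto (fun t => ∫ x, ⟪(v₂ + w₂) t x, φ x⟫) (𝓝[>] 0) (𝓝 c) := by
      have h := hcv₂.add (hP₂ φ hφs hφm)
      rw [add_zero] at h
      refine h.congr' ?_
      filter_upwards [hI] with t ht
      exact (hadd hv₂c hw₂c t ht).symm
    refine ⟨⟨c, hu₁t⟩, ⟨c, hu₂t⟩, ?_⟩
    have h := hu₁t.sub hu₂t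
    rw [sub_self] at h
    refine h.congr' ?_
    filter_upwards [hI] with t ht
    rw [← integral_sub
      (integrable_inner_of_continuous (hu₁.smooth_velocity.isSmooth_slice ht).continuous hφc)
      (integrable_inner_of_continuous (hu₂.smooth_velocity.isSmooth_slice ht).continuous hφc)]
    refine integral_congr_ae (Eventually.of_forall fun x => ?_)
    simp only [inner_sub_left]
  · -- zero mean of `u₁(T_*)`
    show ∫ x, (v₁ + w₁) unitTime x = 0
    simp only [Pi.add_apply]
    rw [integral_add
      ((hv₁c _ hTmem).integrable_of_hasCompactSupport (HasCompactSupport.of_compactSpace _))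
      ((hw₁c _ hTmem).integrable_of_hasCompactSupport (HasCompactSupport.of_compactSpace _))]
    have e1 : ∫ x, v₁ unitTime x = 0 := h₁.hasZeroMean _ hTmem
    have e2 : ∫ x, w₁ unitTime x = 0 := hm₁ _ hTmem
    rw [e1, e2, add_zero]
  · -- zero mean of `u₂(T_*)`
    show ∫ x, (v₂ + w₂) unitTime x = 0
    simp only [Pi.add_apply]
    rw [integral_add
      ((hv₂c _ hTmem).integrable_of_hasCompactSupport (HasCompactSupport.of_compactSpace _))
      ((hw₂c _ hTmem).integrable_of_hasCompactSupport (HasCompactSupport.of_compactSpace _))]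
    have e1 : ∫ x, v₂ unitTime x = 0 := h₂.hasZeroMean _ hTmem
    have e2 : ∫ x, w₂ unitTime x = 0 := hm₂ _ hTmem
    rw [e1, e2, add_zero]
  · -- smallness at `T_*`
    simp only [Pi.add_apply]
    exact ⟨(norm_add_le _ _).trans (by linarith [(hδ x).1, hwT hw₁ x]),
      (norm_add_le _ _).trans (by linarith [(hδ x).2, hwT hw₂ x])⟩

/-- **Coiculescu–Palasek 2025, Thm. 1.2 (with Rmk. 1.3, as rendered by the barrier fact
`CriticalDataSmoothNonuniqueness`) from the principal parts and the CORRECTED perturbation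
theorem**: the hypotheses `hA` (principal parts with their residuals: Def. 3.10, Prop. 3.13,
Prop. 4.1, the `v`-only estimates of §5) and `hB` (Props. 4.2–4.3 in the range `κ ≤ α` in which
their printed proof closes) of `CoiculescuPalasek2025_construction_of_parts'` imply the barrier
fact, the small-data global extension of the last paragraph of §5 being the discharged fact
`CoiculescuPalasek2025_globalExtension_holds` and the two being assembled by
`CriticalDataSmoothNonuniqueness_of_parts`. This is the non-vacuous replacement of
`CriticalDataSmoothNonuniqueness_of_principalParts_of_perturbation`, whose hypothesis
`CoiculescuPalasek2025_perturbation` is refuted (`not_CoiculescuPalasek2025_perturbation`).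
[cite: CoiculescuPalasek2025, Def. 3.10, Prop. 3.13, Props. 4.1–4.3, App. B and §5 (proof of Thm. 1.2)] -/
theorem CriticalDataSmoothNonuniqueness_of_principalParts_of_perturbation'
    (hA : ∀ α : ℝ, 0 < α → α < 1 / 8 →
      ∃ κ : ℝ≥0, 0 < κ ∧ (κ : ℝ) < 1 / 2 - 4 * α ∧
      ∃ (K : ℕ → ℝ) (C : ℝ),
      ∀ (ε₀ η L δ : ℝ), 0 < ε₀ → 0 < η → 0 < δ →
      ∃ (v₁ v₂ : ℝ → UnitAddTorus (Fin 3) → EuclideanSpace ℝ (Fin 3))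
        (F₁ F₂ : ℝ → UnitAddTorus (Fin 3) → (Fin 3 → Fin 3 → ℝ))
        (π₁ π₂ : ℝ → UnitAddTorus (Fin 3) → ℝ),
        IsApproximateSolution unitTime α κ K C η ε₀ v₁ F₁ π₁ ∧
        IsApproximateSolution unitTime α κ K C η ε₀ v₂ F₂ π₂ ∧
        (∃ t₀ ∈ Ioc (0 : ℝ) unitTime, ∃ x₀ : UnitAddTorus (Fin 3),
          L ≤ t₀ ^ ((1 - α) / 2) * ‖v₁ t₀ x₀ - v₂ t₀ x₀‖) ∧
        Tendsto (fun t =>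
            Torus.eHomSobolevSeminorm (-1) (EuclideanSpace.complexify ∘ (v₁ t - v₂ t)))
          (𝓝[>] 0) (𝓝 0) ∧
        Tendsto (fun st : ℝ × ℝ =>
            Torus.eHomSobolevSeminorm (-1) (EuclideanSpace.complexify ∘ (v₁ st.1 - v₁ st.2)))
          ((𝓝[>] (0 : ℝ)) ×ˢ (𝓝[>] (0 : ℝ))) (𝓝 0) ∧
        Tendsto (fun st : ℝ × ℝ =>
            Torus.eHomSobolevSeminorm (-1) (EuclideanSpace.complexify ∘ (v₂ st.1 - v₂ st.2)))
          ((𝓝[>] (0 : ℝ)) ×ˢ (𝓝[>] (0 : ℝ))) (𝓝 0) ∧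
        (∀ φ : UnitAddTorus (Fin 3) → EuclideanSpace ℝ (Fin 3), Torus.IsSmooth φ →
          Torus.HasZeroMean φ →
          ∃ c : ℝ, Tendsto (fun t => ∫ x, ⟪v₁ t x, φ x⟫) (𝓝[>] 0) (𝓝 c) ∧
            Tendsto (fun t => ∫ x, ⟪v₂ t x, φ x⟫) (𝓝[>] 0) (𝓝 c)) ∧
        (∀ x, ‖v₁ unitTime x‖ ≤ δ ∧ ‖v₂ unitTime x‖ ≤ δ))
    (hB : ∀ α : ℝ, 0 < α → α < 1 / 8 →
      ∀ κ : ℝ≥0, 0 < κ → (κ : ℝ) < 1 / 2 - 4 * α → (κ : ℝ) ≤ α →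
      ∀ (K : ℕ → ℝ) (C : ℝ),
      ∃ C₄ : ℝ, 0 < C₄ ∧
      ∀ ε₁ : ℝ, 0 < ε₁ → ε₁ < C₄⁻¹ →
      ∃ ε₀ : ℝ, 0 < ε₀ ∧ ∃ η : ℝ, 0 < η ∧
      ∀ (v : ℝ → UnitAddTorus (Fin 3) → EuclideanSpace ℝ (Fin 3))
        (F : ℝ → UnitAddTorus (Fin 3) → (Fin 3 → Fin 3 → ℝ)) (π : ℝ → UnitAddTorus (Fin 3) → ℝ),
        IsApproximateSolution unitTime α κ K C η ε₀ v F π →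
        ∃ (w : ℝ → UnitAddTorus (Fin 3) → EuclideanSpace ℝ (Fin 3))
          (q : ℝ → UnitAddTorus (Fin 3) → ℝ),
          Torus.IsClassicalNSSolutionOn (Ioc 0 unitTime) 1 0 (v + w) q ∧
          (∀ t ∈ Ioc (0 : ℝ) unitTime, Torus.HasZeroMean (w t)) ∧
          (∀ t ∈ Ioc (0 : ℝ) unitTime, ∀ x, t ^ ((1 - α) / 2) * ‖w t x‖ ≤ ε₁) ∧
          (∀ t ∈ Ioc (0 : ℝ) unitTime,
            ENNReal.ofReal (t ^ (1 - α / 2)) *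
                eHolderNorm κ (iteratedFDeriv ℝ 1 (Torus.lift (w t))) ≤
              ENNReal.ofReal ε₁) ∧
          Tendsto (fun t => Torus.eHomSobolevSeminorm (-1) (EuclideanSpace.complexify ∘ w t))
            (𝓝[>] 0) (𝓝 0) ∧
          ∀ φ : UnitAddTorus (Fin 3) → EuclideanSpace ℝ (Fin 3), Torus.IsSmooth φ →
            Torus.HasZeroMean φ → Tendsto (fun t => ∫ x, ⟪w t x, φ x⟫) (𝓝[>] 0) (𝓝 0)) :
    CriticalDataSmoothNonuniqueness :=
  CriticalDataSmoothNonuniqueness_of_parts (CoiculescuPalasek2025_construction_of_parts' hA hB)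
    CoiculescuPalasek2025_globalExtension_holds

end Literature.Barriers.NavierStokesRegularity
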